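import Summits.BirchSwinnertonDyer.BirchSwinnertonDyer.Theorems.RamifiedHeegnerPairLeafPartnerGenusLift
import HarnessLib

/-!
# Crux U₁ `LeafRankOneUpperAtThree` (stmt-BirchSwinnertonDyer-26022) ∕ U₀ (26024), line `partnerdescent` — partner kernel part 17:
# label (B2) of the descended family — the displayed point is the `K[1]/K`-TRACE of the bottom member: `P↑K[1] = Σ_{g ∈ Gal(K[1]/K)} g·ys(1)`

HONEST FRAMING (lead prover `bsd-line-rhp-p2` g58, explicit-unit seat, cell `bsd-wall`): a SUPPORT file (`--supports 26022 --as helper`)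
for the registered stub (DISPLAY-L) `stub_partnerGenusDisplayLabelledAtThree`. It proves NO stub and closes NO item; BSD is proved for no
curve. Theorems only; no definition, no named fact, no `sorry`.

WHAT. The (B2) conjunct of `ShimuraWalk.LabelsAt W N K ι P ys ε` (Gross (4.1): `P = Tr_{K[1]/K} ys(1)`) for the descended family of the
line: `P = c·desc_K ψ_θ(P_χ)` (part 14), `ys(1) = c·D₁`, `D₁ = desc_{K[1]} ψ_θ((1 − σ₁)·y(3))` (part 15). Two steps:
* §1 `chiSum_eq_sum_lift` — ON THE `V`-SIDE, in `V(K[3])`: `P_χ = Σ_{h ∈ Gal(K[3]/K)} χ(h)·h y = Σ_{g ∈ Gal(K[1]/K)} g̃·(y − σ₁ y)` for ANY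
  choice of `θ`-fixing lifts `g̃` (part 16 §1): the fibres of the restriction `Gal(K[3]/K) → Gal(K[1]/K)` are the pairs `{g̃, g̃σ₁}` (kernel
  `Gal(K[3]/K[1]) = {1, σ₁}`, part 15 §3) on which `χ` takes the values `+1, −1` (`Finset.sum_fiberwise_of_maps_to`).
* §3 `labelB2_of_descents` (after §2, two bridging lemmas `genusTransport_zsmul/sum` for the concrete point-group instance) — push §1 through `ψ_θ` and the injective inclusion `W(K[1]) → W(K[3])` (part 16 §2–§3):
  `(c • P)↑K[1] = Σ_{g ∈ T₁} g·(c • D₁)` for every enumeration `T₁` of `Gal(K[1]/K)` — VERBATIM the (B2) clause.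
[cite: GrossLMS1991, §4 (4.1) (p. 238)] [cite: CaiShuTian2014, §1.1 (P_χ as a Pic(𝒪_c)-sum)] [cite: SilvermanAEC2009, X.5 Cor. 5.4 (iii)]
presearch: as parts 14–16 (genus descent of the χ-component: CLTZ Lemma 2.7 ∕ Thm 2.5 shape; not printed as a trace identity); nothing restated.
-/

set_option linter.dupNamespace false
set_option autoImplicit false

noncomputable section

open scoped Classical

namespace Summit.BirchSwinnertonDyer.BirchSwinnertonDyer.Theorems.LeafPartnerGenusLabelB2

open WeierstrassCurve NumberField Literature.NumberTheory.EllipticCurves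
  Literature.NumberTheory.EllipticCurves.RingClassField
  Summit.BirchSwinnertonDyer.Rank1Residual.X11b.RingClassTower
  Summit.BirchSwinnertonDyer.BirchSwinnertonDyer.Theorems.LeafPartnerGenusTransport
  Summit.BirchSwinnertonDyer.BirchSwinnertonDyer.Theorems.LeafPartnerGenusBottom
  Summit.BirchSwinnertonDyer.BirchSwinnertonDyer.Theorems.LeafPartnerGenusLift

variable {K : Type} [Field K] [NumberField K]

/-! ## §1 The `χ`-sum as a sum of `θ`-fixing lifts of `(1 − σ₁)·y` -/

/-- **`P_χ = Σ_{g ∈ Gal(K[1]/K)} g̃·(y − σ₁·y)`.** Data: the restriction `res : Gal(K[3]/K) → Aut(K[1])` (value formula), the genus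
involution `σ₁ ∈ Gal(K[3]/K[1])` (`σ₁² = 1`, `Gal(K[3]/K[1]) = {1, σ₁}`, `σ₁ θ = −θ`), enumerations `T` of `Gal(K[3]/K)` and `T₁` of
`Gal(K[1]/K)`, and for each `g ∈ T₁` a lift `lift g ∈ Gal(K[3]/K)` with `res (lift g) = g`, `(lift g) θ = θ`. Then for `y ∈ V(K[3])`:
`Σ_{h ∈ T} χ(h)·h y = Σ_{g ∈ T₁} (lift g)·(y − σ₁ y)` — the fibre of `res` over `g` is `{lift g, (lift g)σ₁}` with `χ = +1, −1`.
[cite: GrossLMS1991, §4 (4.1) and the exact sequence 0 → G_n → 𝒢_n → Gal(K_1/K) → 0] -/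
theorem chiSum_eq_sum_lift (hK : IsImaginaryQuadratic K) (ι : K →+* ℂ) (V : WeierstrassCurve ℚ)
    {res : ringClassGal ι 3 →* (ringClassField K ι 1 ≃ₐ[ℚ] ringClassField K ι 1)}
    (hres : ∀ (g : ringClassGal ι 3) (x : ringClassField K ι 1) (y : ringClassField K ι 3),
      (x : ℂ) = (y : ℂ) → ((res g x : ringClassField K ι 1) : ℂ) =
        (((g : ringClassField K ι 3 ≃ₐ[ℚ] ringClassField K ι 3) y : ringClassField K ι 3) : ℂ))
    {σ₁ : ringClassField K ι 3 ≃ₐ[ℚ] ringClassField K ι 3} (hσ₁ : σ₁ ∈ ringClassGalOver ι 3 1) (hσσ : σ₁ * σ₁ = 1)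
    (htwo : ∀ τ ∈ ringClassGalOver ι 3 1, τ = 1 ∨ τ = σ₁)
    {θ : ringClassField K ι 3} (hθ2 : θ ^ 2 = algebraMap ℚ (ringClassField K ι 3) (-3)) (hσθ : σ₁ θ = -θ)
    (T : Finset (ringClassField K ι 3 ≃ₐ[ℚ] ringClassField K ι 3)) (hT : ∀ g, g ∈ T ↔ g ∈ ringClassGal ι 3)
    (T₁ : Finset (ringClassField K ι 1 ≃ₐ[ℚ] ringClassField K ι 1)) (hT₁ : ∀ g, g ∈ T₁ ↔ g ∈ ringClassGal ι 1)
    (lift : (ringClassField K ι 1 ≃ₐ[ℚ] ringClassField K ι 1) → ringClassGal ι 3)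
    (hlift : ∀ g ∈ T₁, res (lift g) = g ∧ (lift g : ringClassField K ι 3 ≃ₐ[ℚ] ringClassField K ι 3) θ = θ)
    (y : (V.baseChange (ringClassField K ι 3)).toAffine.Point) :
    ∑ h ∈ T, ((genusSign θ h : ℤˣ) : ℤ) • pointGalHom V (ringClassField K ι 3) h y =
      ∑ g ∈ T₁, pointGalHom V (ringClassField K ι 3) (lift g : ringClassField K ι 3 ≃ₐ[ℚ] ringClassField K ι 3)
        (y - pointGalHom V (ringClassField K ι 3) σ₁ y) := by
  have h31 : (1 : ℕ) ∣ 3 := one_dvd 3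
  have h3 : (3 : ℕ) ≠ 0 := by norm_num
  have hθ : θ ≠ -θ := ne_neg_of_ne_zero (theta_ne_zero hθ2)
  have hσG : σ₁ ∈ ringClassGal ι 3 := ringClassGalOver_le_ringClassGal ι 3 1 hσ₁
  have hσne : σ₁ ≠ 1 := by rintro rfl; exact hθ hσθ.symm.symm
  -- the restriction, extended by `1` off the Galois group
  set G : (ringClassField K ι 3 ≃ₐ[ℚ] ringClassField K ι 3) → (ringClassField K ι 1 ≃ₐ[ℚ] ringClassField K ι 1) :=
    fun h => if hh : h ∈ ringClassGal ι 3 then res ⟨h, hh⟩ else 1 with hG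
  have hGval : ∀ (h) (hh : h ∈ ringClassGal ι 3), G h = res ⟨h, hh⟩ := fun h hh => by rw [hG]; exact dif_pos hh
  have hmaps : ∀ h ∈ T, G h ∈ T₁ := fun h hh => by
    rw [hGval h ((hT h).mp hh), hT₁]
    exact restrictHom_mem_ringClassGal ι hres _
  rw [← Finset.sum_fiberwise_of_maps_to hmaps]
  refine Finset.sum_congr rfl fun g hg => ?_
  obtain ⟨hresL, hLθ⟩ := hlift g hg
  set L : ringClassField K ι 3 ≃ₐ[ℚ] ringClassField K ι 3 := (lift g : ringClassField K ι 3 ≃ₐ[ℚ] ringClassField K ι 3) with hL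
  have hLG : L ∈ ringClassGal ι 3 := (lift g).2
  have hLσne : L ≠ L * σ₁ := fun h => hσne (mul_left_cancel (a := L) ((mul_one L).trans h)).symm
  -- the fibre over `g` is `{L, L σ₁}`
  have hfib : T.filter (fun h => G h = g) = {L, L * σ₁} := by
    ext h
    simp only [Finset.mem_filter, Finset.mem_insert, Finset.mem_singleton]
    constructor
    · rintro ⟨hhT, hGh⟩
      have hh : h ∈ ringClassGal ι 3 := (hT h).mp hhT
      -- `res (L⁻¹ h) = 1`, so `L⁻¹ h ∈ Gal(K[3]/K[1]) = {1, σ₁}`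
      have hq : res ((lift g)⁻¹ * ⟨h, hh⟩) = 1 := by
        rw [map_mul, map_inv, hresL, ← hGval h hh, hGh, inv_mul_cancel]
      have hmem : (((lift g)⁻¹ * ⟨h, hh⟩ : ringClassGal ι 3) : ringClassField K ι 3 ≃ₐ[ℚ] ringClassField K ι 3) ∈
          ringClassGalOver ι 3 1 :=
        mem_ringClassGalOver_of_restrictHom_mem ι hres le_rfl _ (by rw [hq]; exact Subgroup.one_mem _)
      rcases htwo _ hmem with h1 | h2
      · left
        have : (⟨h, hh⟩ : ringClassGal ι 3) = lift g := by
          have := congrArg (fun x => lift g * x) (Subtype.ext h1 : (lift g)⁻¹ * ⟨h, hh⟩ = 1)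
          simpa using this
        exact congrArg Subtype.val this
      · right
        have e : ((lift g)⁻¹ : ringClassGal ι 3).1 * h = σ₁ := h2
        calc h = L * (L⁻¹ * h) := by rw [← mul_assoc, mul_inv_cancel, one_mul]
          _ = L * σ₁ := by rw [hL]; exact congrArg (L * ·) e
    · rintro (rfl | rfl)
      · exact ⟨(hT _).mpr hLG, by rw [hGval _ hLG]; exact hresL⟩
      · have hm : L * σ₁ ∈ ringClassGal ι 3 := Subgroup.mul_mem _ hLG hσG
        refine ⟨(hT _).mpr hm, ?_⟩
        rw [hGval _ hm]
        have : (⟨L * σ₁, hm⟩ : ringClassGal ι 3) = lift g * ⟨σ₁, hσG⟩ := Subtype.ext rfl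
        rw [this, map_mul, hresL, restrictHom_eq_one_of_mem hK ι h31 h3 hres ⟨σ₁, hσG⟩ hσ₁, mul_one]
  rw [hfib, Finset.sum_pair hLσne]
  -- the two signs
  have hsL : genusSign θ L = 1 := (genusSign_eq_one_iff θ L).mpr hLθ
  have hsLσ : genusSign θ (L * σ₁) = -1 := by
    refine (genusSign_eq_neg_one_iff hθ2 hθ (L * σ₁)).mpr ?_
    change L (σ₁ θ) = -θ
    rw [hσθ, map_neg, hLθ]
  rw [hsL, hsLσ, Units.val_one, one_smul, Units.val_neg, Units.val_one, neg_smul, one_smul, map_mul, map_sub]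
  rfl

/-! ## §2 Bridging `ψ_θ` to the point-group structure at a concrete field

Part 10 defines `genusTransport` over an abstract field with the CLASSICAL `DecidableEq` feeding Mathlib's group law on points; at a
concrete ring class field Lean uses another (propositionally equal) instance. The two lemmas below restate additivity of `ψ_θ` for the
instance in scope (`Subsingleton.elim` on `DecidableEq`). -/

section Bridge

variable (W : WeierstrassCurve ℚ) {W₁ : WeierstrassCurve ℚ} [W₁.IsCharNeTwoNF] (C₁ : VariableChange ℚ) (hC₁ : C₁ • W = W₁)
  {V : WeierstrassCurve ℚ} (CV : VariableChange ℚ) (hV : CV • W₁.quadraticTwist (-3) = V)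
  {L : Type} [Field L] [Algebra ℚ L] {θ : L}

/-- `ψ_θ(c • z) = c • ψ_θ(z)` for the point-group structure in scope. [folklore] -/
theorem genusTransport_zsmul [d : DecidableEq L] (hθ : θ ^ 2 = algebraMap ℚ L (-3)) (c : ℤ) (z : (V.baseChange L).toAffine.Point) :
    genusTransport W C₁ hC₁ CV hV hθ (c • z) = c • genusTransport W C₁ hC₁ CV hV hθ z := by
  obtain rfl : d = fun a b => Classical.propDecidable (a = b) := Subsingleton.elim _ _
  exact map_zsmul _ c z

/-- `ψ_θ(Σ_i z_i) = Σ_i ψ_θ(z_i)` for the point-group structure in scope. [folklore] -/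
theorem genusTransport_sum [d : DecidableEq L] (hθ : θ ^ 2 = algebraMap ℚ L (-3)) {ι' : Type} (s : Finset ι')
    (f : ι' → (V.baseChange L).toAffine.Point) :
    genusTransport W C₁ hC₁ CV hV hθ (∑ i ∈ s, f i) = ∑ i ∈ s, genusTransport W C₁ hC₁ CV hV hθ (f i) := by
  obtain rfl : d = fun a b => Classical.propDecidable (a = b) := Subsingleton.elim _ _
  exact map_sum _ f s

end Bridge

/-! ## §3 Label (B2): the displayed point is the `K[1]/K`-trace of the bottom member -/

section B2

variable (W : WeierstrassCurve ℚ) {W₁ : WeierstrassCurve ℚ} [W₁.IsCharNeTwoNF] (C₁ : VariableChange ℚ) (hC₁ : C₁ • W = W₁)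
  {V : WeierstrassCurve ℚ} (CV : VariableChange ℚ) (hV : CV • W₁.quadraticTwist (-3) = V)

/-- **Label (B2) for the descended family.** With the data of §1, the bottom descent `D₁ ∈ W(K[1])` (`D₁↑K[3] = ψ_θ(y − σ₁ y)`, part 15)
and the displayed descent `P₁ ∈ W(K)` (`P₁↑K[3] = ψ_θ(P_χ)`, part 14): for every integer `c`,
`(c • P₁)↑K[1] = Σ_{g ∈ T₁} g·(c • D₁)` — the (B2) clause of `ShimuraWalk.LabelsAt` for `P := c • P₁`, `ys 1 := c • D₁`. PROOF: read in
`W(K[3])` through the injective inclusion; there both sides are `ψ_θ(c • P_χ)` by §1 and part 16 §2. [cite: GrossLMS1991, §4 (4.1) (p. 238)] -/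
theorem labelB2_of_descents (hK : IsImaginaryQuadratic K) (ι : K →+* ℂ)
    (hle : ringClassField K ι 1 ≤ ringClassField K ι 3)
    {res : ringClassGal ι 3 →* (ringClassField K ι 1 ≃ₐ[ℚ] ringClassField K ι 1)}
    (hres : ∀ (g : ringClassGal ι 3) (x : ringClassField K ι 1) (y : ringClassField K ι 3),
      (x : ℂ) = (y : ℂ) → ((res g x : ringClassField K ι 1) : ℂ) =
        (((g : ringClassField K ι 3 ≃ₐ[ℚ] ringClassField K ι 3) y : ringClassField K ι 3) : ℂ))
    {σ₁ : ringClassField K ι 3 ≃ₐ[ℚ] ringClassField K ι 3} (hσ₁ : σ₁ ∈ ringClassGalOver ι 3 1) (hσσ : σ₁ * σ₁ = 1)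
    (htwo : ∀ τ ∈ ringClassGalOver ι 3 1, τ = 1 ∨ τ = σ₁)
    {θ : ringClassField K ι 3} (hθ2 : θ ^ 2 = algebraMap ℚ (ringClassField K ι 3) (-3)) (hσθ : σ₁ θ = -θ)
    (T : Finset (ringClassField K ι 3 ≃ₐ[ℚ] ringClassField K ι 3)) (hT : ∀ g, g ∈ T ↔ g ∈ ringClassGal ι 3)
    (T₁ : Finset (ringClassField K ι 1 ≃ₐ[ℚ] ringClassField K ι 1)) (hT₁ : ∀ g, g ∈ T₁ ↔ g ∈ ringClassGal ι 1)
    (y : (V.baseChange (ringClassField K ι 3)).toAffine.Point)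
    (P₁ : (W.baseChange K).toAffine.Point)
    (hP₁ : Affine.Point.map (algebraMap K (ringClassField K ι 3)).toRatAlgHom P₁ =
      genusTransport W C₁ hC₁ CV hV hθ2 (∑ h ∈ T, ((genusSign θ h : ℤˣ) : ℤ) • pointGalHom V (ringClassField K ι 3) h y))
    (D₁ : (W.baseChange (ringClassField K ι 1)).toAffine.Point)
    (hD₁ : Affine.Point.map ((RingClassField.inclusion ι hle).restrictScalars ℚ) D₁ =
      genusTransport W C₁ hC₁ CV hV hθ2 (y - pointGalHom V (ringClassField K ι 3) σ₁ y))
    (c : ℤ) :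
    Affine.Point.map (algebraMap K (ringClassField K ι 1)).toRatAlgHom (c • P₁) =
      ∑ g ∈ T₁, pointGalHom W (ringClassField K ι 1) g (c • D₁) := by
  -- θ-fixing lifts of the elements of `T₁`
  have hl : ∀ g : ringClassField K ι 1 ≃ₐ[ℚ] ringClassField K ι 1, ∃ gt : ringClassGal ι 3, g ∈ T₁ →
      res gt = g ∧ (gt : ringClassField K ι 3 ≃ₐ[ℚ] ringClassField K ι 3) θ = θ := by
    intro g
    by_cases hg : g ∈ T₁
    · obtain ⟨gt, h1, h2⟩ := exists_lift_apply_theta_eq hK ι one_ne_zero hres hσ₁ hθ2 hσθ ((hT₁ g).mp hg)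
      exact ⟨gt, fun _ => ⟨h1, h2⟩⟩
    · exact ⟨1, fun h => absurd h hg⟩
  choose lift hlift using hl
  -- read both sides in `W(K[3])`
  apply map_inclusion_injective' W ι hle
  -- LHS: `K → K[1] → K[3]` is `K → K[3]`
  have hcomp : ((RingClassField.inclusion ι hle).restrictScalars ℚ).comp (algebraMap K (ringClassField K ι 1)).toRatAlgHom =
      (algebraMap K (ringClassField K ι 3)).toRatAlgHom := by
    refine AlgHom.ext fun k => Subtype.ext ?_
    change ((RingClassField.inclusion ι hle (algebraMap K (ringClassField K ι 1) k) : ringClassField K ι 3) : ℂ) =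
      ((algebraMap K (ringClassField K ι 3) k : ringClassField K ι 3) : ℂ)
    rw [RingClassField.coe_inclusion, coe_algebraMap_ringClassField, coe_algebraMap_ringClassField]
  rw [Affine.Point.map_map, hcomp, map_zsmul (Affine.Point.map (algebraMap K (ringClassField K ι 3)).toRatAlgHom) c P₁, hP₁]
  -- RHS, term by term: `(g·(c•D₁))↑ = ψ_θ((lift g)·(c•(y − σ₁ y)))`
  have hterm : ∀ g ∈ T₁,
      Affine.Point.map ((RingClassField.inclusion ι hle).restrictScalars ℚ) (pointGalHom W (ringClassField K ι 1) g (c • D₁)) =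
        genusTransport W C₁ hC₁ CV hV hθ2 (pointGalHom V (ringClassField K ι 3)
          (lift g : ringClassField K ι 3 ≃ₐ[ℚ] ringClassField K ι 3) (c • (y - pointGalHom V (ringClassField K ι 3) σ₁ y))) := by
    intro g hg
    obtain ⟨hresg, hgθ⟩ := hlift g hg
    have hD' : Affine.Point.map ((RingClassField.inclusion ι hle).restrictScalars ℚ) (c • D₁) =
        genusTransport W C₁ hC₁ CV hV hθ2 (c • (y - pointGalHom V (ringClassField K ι 3) σ₁ y)) := by
      rw [map_zsmul (Affine.Point.map ((RingClassField.inclusion ι hle).restrictScalars ℚ)) c D₁, hD₁, ← genusTransport_zsmul]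
    have h := map_inclusion_pointGalHom_res_eq W C₁ hC₁ CV hV hK ι one_ne_zero hle hres hθ2 (lift g) hgθ _ _ hD'
    rw [hresg] at h
    exact h
  rw [map_sum (Affine.Point.map ((RingClassField.inclusion ι hle).restrictScalars ℚ)), Finset.sum_congr rfl hterm,
    ← genusTransport_sum, ← genusTransport_zsmul]
  congr 1
  rw [chiSum_eq_sum_lift hK ι V hres hσ₁ hσσ htwo hθ2 hσθ T hT T₁ hT₁ lift hlift y, Finset.smul_sum]
  exact Finset.sum_congr rfl fun g _ => (map_zsmul _ c _).symm

end B2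

end Summit.BirchSwinnertonDyer.BirchSwinnertonDyer.Theorems.LeafPartnerGenusLabelB2

end
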